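import Mathlib
import HarnessLib
import Summits.ValiantsHypothesis.ValiantsHypothesis.Theorems.MonotoneRestorationOrbitRestorationLinearVolumeQPImpliesVH

/-!
# The `m_n = 1` rung of R1 already decides the summit: quasi-polynomial-orbit symmetric circuits for `VP`
# homomorphism polynomials of SINGLE patterns with `n + O(1)` rows, columns and edges ⇒ VP ≠ VNP

Route MonotoneRestoration, aside R1 = `OrbitRestorationLinearVolumeQP` (stmt-ValiantsHypothesis-18294).  The proof of
`valiantsHypothesis_of_orbitRestorationLinearVolumeQP` (`…LinearVolumeQPImpliesVH.lean`) applies R1 only to ONE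
family of single patterns `F_n = (Fin (a n) ⊔ Fin (b n), E n)` with `a n, b n, |E n| ≤ n + c₀` (the separating
patterns extracted from the permanent's hom expansion at the Dawar–Wilsenach orders; index `0` elsewhere).  This file
records the correspondingly WEAKER deciding hypothesis, stated inline (no new definition):

* `valiantsHypothesis_of_singlePatternOrbitRestoration` — if every `VP` family of the form `(hom_{F_n,n})_n` with
  `a n, b n, |E n| ≤ n + c₀` (one bipartite multigraph pattern per level, at most `n + O(1)` rows, columns and
  edges) has square-symmetric circuits of orbit size `≤ 2^((log₂ n + c)^c)`, then `VP ≠ VNP` over `ℂ`.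

This is the item's informal "first sub-rung `m_n = 1` (single linear-volume patterns)" — shown here to be
VH-strength on its own (Dwivedi–Pago–Seppelt 2026 Outlook Q3 for single patterns of volume `≤ 2n + O(1)` at
quasi-polynomial scale).  Honest framing: an implication; the rung, R1, the crux and VP ≠ VNP remain open.
-/

noncomputable section

-- `Summit.ValiantsHypothesis.ValiantsHypothesis.…` is the tree's single-conjunct layout (Sub = Summit).
set_option linter.dupNamespace false

namespace Summit.ValiantsHypothesis.ValiantsHypothesis.Theorems

namespace OrbitRestorationLinearVolumeQPVHStrength

open MvPolynomial
open Summit.ValiantsHypothesis.ValiantsHypothesis.Theses.MonotoneRestoration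
open Literature.Computability.AlgebraicComplexity
open Literature.ModelTheory.FiniteModelTheory

/-- **The single-pattern rung decides the summit.**  Suppose that for every constant `c₀` and every bipartite
multigraph pattern family `F_n = (Fin (a n) ⊔ Fin (b n), E n)` with `a n, b n, |E n| ≤ n + c₀` whose homomorphism
polynomials form a `VP` family there is `c` with square-symmetric circuits for `hom_{F_n,n}` of orbit size
`≤ 2^((log₂ n + c)^c)` at every `n`.  Then `VP ≠ VNP` over `ℂ`.  Proof: the separating family of
`valiantsHypothesis_of_orbitRestorationLinearVolumeQP` (Dawar–Wilsenach Thm 7.2 pairs, a separating generator of the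
permanent's hom expansion at each order, index `0` at the other orders) has exactly this shape; it is `VNP`
(`HomPolyVNP.isVNPFamily_homPoly`), hence `VP` under `VP = VNP`, and polylog-separating, which the orbit-form
Dawar–Wilsenach pipeline forbids for families with quasi-polynomial-orbit symmetric circuits.
[cite: DawarWilsenach2025, Thm 7.2, Thm 5.1, §6, §7.1; DwivediPagoSeppelt2026, Outlook Q3] -/
theorem valiantsHypothesis_of_singlePatternOrbitRestoration
    (h : ∀ (c₀ : ℕ) (a b : ℕ → ℕ) (E : (n : ℕ) → Multiset (Fin (a n) × Fin (b n))),
      (∀ n, a n ≤ n + c₀) → (∀ n, b n ≤ n + c₀) → (∀ n, Multiset.card (E n) ≤ n + c₀) →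
      IsVPFamily (fun n => homPoly (E n) n ℂ) →
      ∃ c : ℕ, ∀ n : ℕ, ∃ (G : Type) (_ : Fintype G) (C : LabelledArithCircuit ℂ (Fin n × Fin n) Unit G),
        C.IsSymmetric (Equiv.Perm (Fin n)) ∧ C.eval (C.output ()) = homPoly (E n) n ℂ ∧
          C.orbitSize (Equiv.Perm (Fin n)) ≤ 2 ^ ((Nat.log 2 n + c) ^ c)) :
    ValiantsHypothesis := by
  classical
  -- adapted from `valiantsHypothesis_of_orbitRestorationLinearVolumeQP` (same separating family)
  obtain ⟨c, hc⟩ := CFIMatching.DawarWilsenach2025_thm72_family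
  choose m hm X Y hXb hYb hXY hpm using hc
  have hne : ∀ k, eval (Set.indicator {ij : Fin (m k) × Fin (m k) | (X k).Adj ij.1 ij.2} 1)
      (perPoly (Fin (m k)) ℂ) ≠
      eval (Set.indicator {ij : Fin (m k) × Fin (m k) | (Y k).Adj ij.1 ij.2} 1) (perPoly (Fin (m k)) ℂ) := by
    intro k
    obtain ⟨s, t, hs, hst⟩ := hXb k
    obtain ⟨s', t', hs', hst'⟩ := hYb k
    rw [indicator_adj_eq, indicator_adj_eq]
    exact eval_perPoly_adj_ne_of_card_perfectMatchings_ne hs hst hs' hst' ℂ (hpm k)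
  have hkm : ∀ k, k < m k := by
    intro k
    by_contra hk
    have hk' : m k ≤ k := not_lt.mp hk
    apply hpm k
    rcases Nat.eq_zero_or_pos (m k) with h0 | hpos
    · have hXYeq : X k = Y k := by
        ext u v
        exact absurd u.isLt (by omega)
      rw [hXYeq]
    · rcases Nat.eq_zero_or_pos k with hk0 | hkpos
      · omega
      · obtain ⟨e⟩ := (hXY k).nonempty_iso hkpos (by simpa using hk')
        exact Literature.Probability.LatticeModels.card_perfectMatchings_eq_of_iso e
  choose a b E ha hb hE hsepk using fun k => exists_pattern_separating (m k) (X k) (Y k) (hne k)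
  let ksel : ℕ → ℕ := fun n => if h : ∃ k, m k = n then h.choose else 0
  have hksel : ∀ k, m (ksel (m k)) = m k := by
    intro k
    have h : ∃ k', m k' = m k := ⟨k, rfl⟩
    simp only [ksel, dif_pos h]
    exact h.choose_spec
  have hm0 : m 0 ≤ c := by simpa using hm 0
  have hsize : ∀ n, a (ksel n) ≤ n + c ∧ b (ksel n) ≤ n + c ∧ Multiset.card (E (ksel n)) ≤ n + c := by
    intro n
    by_cases h : ∃ k, m k = n
    · have hk : m (ksel n) = n := by
        simp only [ksel, dif_pos h]
        exact h.choose_spec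
      have h1 := ha (ksel n); have h2 := hb (ksel n); have h3 := hE (ksel n)
      rw [hk] at h1 h2 h3
      exact ⟨by omega, by omega, by omega⟩
    · have hk0 : ksel n = 0 := by simp only [ksel, dif_neg h]
      rw [hk0]
      have h1 := ha 0; have h2 := hb 0; have h3 := hE 0
      exact ⟨by omega, by omega, by omega⟩
  -- the family `f n = hom_{F_{ksel n}, n}` is polylog-separating
  have hsep : ∀ c' N : ℕ, ∃ n : ℕ, N ≤ n ∧ ∃ X' Y' : SimpleGraph (Fin n),
      CkEquiv ((Nat.log 2 n + c') ^ c') X' Y' ∧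
        eval (Set.indicator {ij : Fin n × Fin n | X'.Adj ij.1 ij.2} 1) (homPoly (E (ksel n)) n ℂ) ≠
          eval (Set.indicator {ij : Fin n × Fin n | Y'.Adj ij.1 ij.2} 1) (homPoly (E (ksel n)) n ℂ) := by
    intro c' N
    obtain ⟨k₁, hk₁⟩ := symmetricLB_logPow_lt c' (δ := 1 / (2 * (c : ℝ) + 2)) (by positivity)
    obtain ⟨M₀, hM₀N, hM₀K⟩ : ∃ M₀ : ℕ, N ≤ M₀ ∧ 2 ^ k₁ ≤ M₀ :=
      ⟨max N (2 ^ k₁), le_max_left _ _, le_max_right _ _⟩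
    obtain ⟨k₀, hk₀_def⟩ : ∃ k₀ : ℕ, k₀ = M₀ + c + 1 := ⟨_, rfl⟩
    obtain ⟨k', hk'_def⟩ : ∃ k' : ℕ, k' = ksel (m k₀) := ⟨_, rfl⟩
    have hmk' : m k' = m k₀ := by rw [hk'_def]; exact hksel k₀
    have hk₀m : k₀ < m k₀ := hkm k₀
    have hsel : ksel (m k') = k' := by rw [hmk', hk'_def]
    have hk'1 : 1 ≤ k' := by
      by_contra h0
      have hz : k' = 0 := by omega
      have : m k' ≤ c := by rw [hz]; exact hm0
      omega
    refine ⟨m k', by omega, X k', Y k', ?_, ?_⟩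
    · refine (hXY k').mono ?_
      have h2 : 2 ^ k₁ ≤ m k' := hM₀K.trans (by omega)
      have hlt := hk₁ (m k') h2
      have hmle : ((m k' : ℕ) : ℝ) ≤ (c : ℝ) * (k' : ℝ) + (c : ℝ) := by exact_mod_cast hm k'
      have hk1r : (1 : ℝ) ≤ (k' : ℝ) := by exact_mod_cast hk'1
      have hc0 : (0 : ℝ) ≤ (c : ℝ) := Nat.cast_nonneg c
      have h3 : 1 / (2 * (c : ℝ) + 2) * ((m k' : ℕ) : ℝ) ≤ (k' : ℝ) := by
        rw [one_div, inv_mul_le_iff₀ (by positivity)]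
        nlinarith [mul_nonneg hc0 (sub_nonneg.mpr hk1r)]
      have h4 : ((Nat.log 2 (m k') + c') ^ c' : ℝ) < (k' : ℝ) := hlt.trans_le h3
      have h5 : (((Nat.log 2 (m k') + c') ^ c' : ℕ) : ℝ) < (k' : ℝ) := by push_cast; exact h4
      exact (by exact_mod_cast h5 : (Nat.log 2 (m k') + c') ^ c' < k').le
    · rw [hsel]
      exact hsepk k'
  -- under `VP = VNP` the family is `VP`, the rung gives quasi-polynomial orbits, the pipeline forbids them
  show VP ℂ ≠ VNP ℂ
  intro hEq
  have hVNP : IsVNPFamily fun n => homPoly (E (ksel n)) n ℂ := by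
    refine HomPolyVNP.isVNPFamily_homPoly ℂ (fun n => a (ksel n)) (fun n => b (ksel n)) (fun n => E (ksel n))
      (c + 1) (fun n => ?_) (fun n => ?_) (fun n => ?_)
    all_goals
      have hpow : n + c ≤ (n + 2) ^ (c + 1) := by
        have h5 : 2 ^ c ≤ (n + 2) ^ c := Nat.pow_le_pow_left (by omega) _
        have h4 : c ≤ 2 ^ c := Nat.lt_two_pow_self.le
        calc n + c ≤ (n + 2) * (n + 2) ^ c := by nlinarith [Nat.one_le_pow c (n + 2) (by omega)]
          _ = (n + 2) ^ (c + 1) := by ring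
    · exact (hsize n).1.trans hpow
    · exact (hsize n).2.1.trans hpow
    · exact (hsize n).2.2.trans hpow
  have hVP : IsVPFamily fun n => homPoly (E (ksel n)) n ℂ := isVPFamily_of_isVNPFamily_of_VP_eq_VNP hEq hVNP
  obtain ⟨c₁, hc₁⟩ := h c (fun n => a (ksel n)) (fun n => b (ksel n)) (fun n => E (ksel n))
    (fun n => (hsize n).1) (fun n => (hsize n).2.1) (fun n => (hsize n).2.2) hVP
  exact not_qpOrbitSymmetric_of_polylogSeparating (fun n => homPoly (E (ksel n)) n ℂ) hsep ⟨c₁, hc₁⟩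

end OrbitRestorationLinearVolumeQPVHStrength

end Summit.ValiantsHypothesis.ValiantsHypothesis.Theorems

end
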